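import Mathlib
import Summits.CriticalPhenomena.CardyFormulaZ2.Theorems.CardySelfRefinementDefs
import Summits.CriticalPhenomena.CardyFormulaZ2.Theorems.CardySelfRefinementRussoDriftPolynomial
import HarnessLib

/-!
# Stub `stub_boundaryRelevance` of line `far-field-is-a-quarter-turn` (crux `TrivialSectorRate`,
stmt-CriticalPhenomena-10266), input W2′: OPPOSITE-STATE SUB-EDGES OF ONE BUNDLE HAVE
COIN-DISJOINT CERTIFICATES

Reimer's inequality holds on the COIN space of `M_k = (coin product).map (cfg k)`
(`prodBernoulli_reimer_local`), so `M_k(A ∩ B-type event) ≤ M_k(A) · M_k(B)` as soon as the edge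
witnesses of `A` and `B` can be certified by DISJOINT coin sets.  Two sub-edges of one bundle
(coarse edge: same coarse base `tb`, same direction) read a common shared coin `sh = (tb, d, 1)`
and a common selector `sel = (tb, d, 2)` besides their own coins `own = (v, d, 0)`; two CLOSED (or
two OPEN) sub-edges of one bundle cannot in general be certified disjointly
(`…StubSixArmDecaySubMultObstruction.lean`), but two sub-edges with OPPOSITE states can: a mixed
bundle has its selector OFF in the actual coin configuration `S` (selector on makes every
sub-edge read the shared coin), and then, writing `x ≐ S` for "membership of the coin `x` frozen
to its actual value in `S`",

* if `own(e) ∈ S ↔ sh ∈ S` the certificate `{own(e), sh} ≐ S` forces the state of `e` whatever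
  the selector does,
* otherwise the certificate `{own(e), sel} ≐ S` does (selector frozen off, own coin frozen);

two opposite sub-edges `e`, `e'` have opposite own coins, so exactly one of them agrees with
`sh`: one certificate uses `sh`, the other `sel`, and the own coins are distinct — disjoint.

* `exists_disjoint_coinCertificates_of_oppositeStates` (registered helper W2′) — for a coin
  configuration `S` and two disjoint finite sets `K`, `L` of lattice edges such that every
  same-bundle pair `e ∈ K`, `e' ∈ L` has OPPOSITE states in `cfg k S`, there are disjoint finite
  coin sets `CK`, `CL` such that every `T` agreeing with `S` on `CK` (resp. `CL`) gives every
  edge of `K` (resp. `L`) the same state under `cfg k T` as under `cfg k S`.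

The proof is a finite case analysis on the three coins of a fine edge (per-edge certificate
`exists_coinCertificate`, chosen from the actual coin values; `CK`, `CL` are the unions over the
representatives `vd ∈ edgeOf ⁻¹' K`, `edgeOf ⁻¹' L`).

Target file:
`Summits/CriticalPhenomena/CardyFormulaZ2/Theorems/CardySelfRefinementTrivialSectorRateStubBoundaryRelevanceCoinCertificates.lean`.
-/

noncomputable section

namespace Summit.CriticalPhenomena.CardyFormulaZ2.Theorems.CardySelfRefinement.FarField

open Set MeasureTheory
open Literature.Probability.LatticeModels Literature.Probability.Percolation
open Literature.Probability.Percolation.QuadCrossing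
open Summit.CriticalPhenomena.CardyFormulaZ2.Theses.CardySelfRefinement

/-! ### Representatives and read-out of lattice edges -/

/-- A lattice edge `edgeOf vd` is open in `cfg k S` iff its read-out `opn k S vd` holds
(the representative `vd` of a fine edge is unique, `edgeOf_injective`). -/
private theorem edgeOf_mem_cfg_iff_opn (k : ℕ) (S : Set Coin) (vd : Site 2 × Fin 2) :
    edgeOf vd ∈ cfg k S ↔ opn k S vd := by
  refine ⟨?_, fun h => ⟨vd.1, vd.2, rfl, h⟩⟩
  rintro ⟨v', d', he, hopn⟩
  obtain rfl : vd = (v', d') := edgeOf_injective (a₁ := vd) (a₂ := (v', d')) he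
  exact hopn

/-- Every nearest-neighbour edge of `ℤ²` has a representative: it is `edgeOf vd` for some
`vd = (v, d)` (`v` the endpoint with the smaller `d`-coordinate). -/
private theorem exists_edgeOf_eq_of_mem_edgeSet {e : Sym2 (Site 2)}
    (he : e ∈ (zdGraph 2).edgeSet) : ∃ vd : Site 2 × Fin 2, edgeOf vd = e := by
  obtain ⟨u, i, rfl⟩ := mem_edgeSet_zdGraph_iff.1 he
  refine ⟨(u, i), ?_⟩
  have hdir : dirVec i = Pi.single i 1 := by
    funext j
    fin_cases i <;> fin_cases j <;> simp [dirVec]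
  simp only [edgeOf, hdir]

/-- Equal coins have equal sites, directions and layers. -/
private theorem coin_eq_elim {a b : Site 2} {c d : Fin 2} {i j : Fin 3}
    (h : ((a, c, i) : Coin) = (b, d, j)) : a = b ∧ c = d ∧ i = j := by
  simp only [Prod.mk.injEq] at h
  exact h

/-- With the selector of its bundle ON, an axial edge reads the shared coin. -/
private theorem opn_iff_shared_of_sel_mem {k : ℕ} {S : Set Coin} {vd : Site 2 × Fin 2}
    (hax : ax k vd) (hsel : (tb k vd, vd.2, (2 : Fin 3)) ∈ S) :
    opn k S vd ↔ (tb k vd, vd.2, (1 : Fin 3)) ∈ S := by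
  simp only [opn, if_pos hax]
  tauto

/-! ### The per-edge certificate -/

/-- **Per-edge coin certificate.**  For every fine edge `vd` and coin configuration `S` there is
a set `C` of coins of `vd` (a subset of `coinsOf k vd`) such that: every `T` agreeing with `S` on
`C` gives `vd` the same read-out; `C` contains a non-own coin only if `vd` is axial; if `vd` is
axial and `C` contains the shared coin, the state of `vd` IS the shared coin; if `vd` is axial,
`C` contains the selector and the selector is off, the state of `vd` is the NEGATION of the
shared coin.  (Choice: non-axial `{own}`; axial with selector on `{sel, sh}`; axial with selector
off `{own, sh}` if `own ∈ S ↔ sh ∈ S`, else `{own, sel}`.) -/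
private theorem exists_coinCertificate (k : ℕ) (S : Set Coin) (vd : Site 2 × Fin 2) :
    ∃ C : Set Coin, C ⊆ coinsOf k vd ∧
      (∀ T : Set Coin, (∀ i ∈ C, (i ∈ T ↔ i ∈ S)) → (opn k T vd ↔ opn k S vd)) ∧
      (∀ i ∈ C, i.2.2 ≠ 0 → ax k vd) ∧
      (ax k vd → (tb k vd, vd.2, (1 : Fin 3)) ∈ C →
        (opn k S vd ↔ (tb k vd, vd.2, (1 : Fin 3)) ∈ S)) ∧
      (ax k vd → (tb k vd, vd.2, (2 : Fin 3)) ∈ C → (tb k vd, vd.2, (2 : Fin 3)) ∉ S →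
        (opn k S vd ↔ (tb k vd, vd.2, (1 : Fin 3)) ∉ S)) := by
  by_cases hax : ax k vd
  · -- axial edge: the read-out is `(sel ∧ sh) ∨ (¬ sel ∧ own)`
    have hopn : ∀ T : Set Coin, opn k T vd ↔
        ((tb k vd, vd.2, (2 : Fin 3)) ∈ T ∧ (tb k vd, vd.2, (1 : Fin 3)) ∈ T) ∨
          ((tb k vd, vd.2, (2 : Fin 3)) ∉ T ∧ (vd.1, vd.2, (0 : Fin 3)) ∈ T) := fun T => by
      simp only [opn, if_pos hax]
    by_cases hsel : (tb k vd, vd.2, (2 : Fin 3)) ∈ S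
    · -- selector on: freeze selector and shared coin
      refine ⟨{(tb k vd, vd.2, (2 : Fin 3)), (tb k vd, vd.2, (1 : Fin 3))}, ?_, ?_,
        fun _ _ _ => hax, ?_, fun _ _ h => absurd hsel h⟩
      · intro i hi
        simp only [Set.mem_insert_iff, Set.mem_singleton_iff] at hi
        simp only [coinsOf, Set.mem_insert_iff, Set.mem_singleton_iff]
        tauto
      · intro T hT
        have h2 := hT (tb k vd, vd.2, (2 : Fin 3)) (by simp)
        have h1 := hT (tb k vd, vd.2, (1 : Fin 3)) (by simp)
        rw [hopn, hopn]
        tauto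
      · intro _ _
        rw [hopn]
        tauto
    · by_cases hag : ((vd.1, vd.2, (0 : Fin 3)) ∈ S ↔ (tb k vd, vd.2, (1 : Fin 3)) ∈ S)
      · -- selector off, own coin agrees with the shared coin: freeze own and shared
        refine ⟨{(vd.1, vd.2, (0 : Fin 3)), (tb k vd, vd.2, (1 : Fin 3))}, ?_, ?_,
          fun _ _ _ => hax, ?_, ?_⟩
        · intro i hi
          simp only [Set.mem_insert_iff, Set.mem_singleton_iff] at hi
          simp only [coinsOf, Set.mem_insert_iff, Set.mem_singleton_iff]
          tauto
        · intro T hT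
          have h0 := hT (vd.1, vd.2, (0 : Fin 3)) (by simp)
          have h1 := hT (tb k vd, vd.2, (1 : Fin 3)) (by simp)
          rw [hopn, hopn]
          tauto
        · intro _ _
          rw [hopn]
          tauto
        · intro _ hmem _
          exfalso
          simp only [Set.mem_insert_iff, Set.mem_singleton_iff] at hmem
          rcases hmem with h | h
          · exact absurd (coin_eq_elim h).2.2 (by decide)
          · exact absurd (coin_eq_elim h).2.2 (by decide)
      · -- selector off, own coin disagrees with the shared coin: freeze own and selector
        refine ⟨{(vd.1, vd.2, (0 : Fin 3)), (tb k vd, vd.2, (2 : Fin 3))}, ?_, ?_,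
          fun _ _ _ => hax, ?_, ?_⟩
        · intro i hi
          simp only [Set.mem_insert_iff, Set.mem_singleton_iff] at hi
          simp only [coinsOf, Set.mem_insert_iff, Set.mem_singleton_iff]
          tauto
        · intro T hT
          have h0 := hT (vd.1, vd.2, (0 : Fin 3)) (by simp)
          have h2 := hT (tb k vd, vd.2, (2 : Fin 3)) (by simp)
          rw [hopn, hopn]
          tauto
        · intro _ hmem
          exfalso
          simp only [Set.mem_insert_iff, Set.mem_singleton_iff] at hmem
          rcases hmem with h | h
          · exact absurd (coin_eq_elim h).2.2 (by decide)
          · exact absurd (coin_eq_elim h).2.2 (by decide)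
        · intro _ _ _
          rw [hopn]
          tauto
  · -- non-axial edge: the read-out is the own coin
    refine ⟨{(vd.1, vd.2, (0 : Fin 3))}, ?_, ?_, ?_, fun h => absurd h hax, fun h => absurd h hax⟩
    · intro i hi
      rw [Set.mem_singleton_iff] at hi
      subst hi
      simp only [coinsOf, Set.mem_insert_iff, Set.mem_singleton_iff, true_or]
    · intro T hT
      have h0 := hT (vd.1, vd.2, (0 : Fin 3)) (Set.mem_singleton _)
      simp only [opn, if_neg hax]
      exact h0
    · intro i hi h0
      rw [Set.mem_singleton_iff] at hi
      subst hi
      exact absurd rfl h0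

/-! ### The registered helper -/

/-- **W2′: opposite-state sub-edges of one bundle have coin-disjoint certificates under the
route's read-out `cfg k`.**  For a lattice coin configuration `S` and two disjoint finite sets
`K`, `L` of nearest-neighbour edges of `ℤ²` such that no bundle (coarse edge: same coarse base
`tb`, same direction, both axial) carries an edge of `K` and an edge of `L` with the SAME state
in `cfg k S`, there are disjoint finite coin sets `CK`, `CL` whose cylinders at `S` force the
states of `K`, resp. `L`: every `T` agreeing with `S` on `CK` gives each edge of `K` its
`S`-state, and likewise for `CL` and `L`.  (Per-edge certificates `exists_coinCertificate`; inside
a mixed bundle the selector is off and the open and the closed side use different non-own coins.) -/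
theorem exists_disjoint_coinCertificates_of_oppositeStates (k : ℕ) (S : Set Coin)
    (K L : Finset (Sym2 (Site 2))) (hK : ∀ e ∈ K, e ∈ (zdGraph 2).edgeSet)
    (hL : ∀ e ∈ L, e ∈ (zdGraph 2).edgeSet) (hKL : Disjoint K L)
    (hopp : ∀ vd vd' : Site 2 × Fin 2, edgeOf vd ∈ K → edgeOf vd' ∈ L → ax k vd → ax k vd' →
      tb k vd = tb k vd' → vd.2 = vd'.2 → (edgeOf vd ∈ cfg k S ↔ edgeOf vd' ∉ cfg k S)) :
    ∃ CK CL : Set Coin, Disjoint CK CL ∧ CK.Finite ∧ CL.Finite ∧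
      (∀ T : Set Coin, (∀ i ∈ CK, i ∈ T ↔ i ∈ S) → ∀ e ∈ K, (e ∈ cfg k T ↔ e ∈ cfg k S)) ∧
      (∀ T : Set Coin, (∀ i ∈ CL, i ∈ T ↔ i ∈ S) → ∀ e ∈ L, (e ∈ cfg k T ↔ e ∈ cfg k S)) := by
  choose cert hsub hcert haxC hsh hsel using exists_coinCertificate k S
  -- finiteness and certification of the union of the certificates over a finite edge set
  have hfin : ∀ W : Finset (Sym2 (Site 2)),
      (⋃ vd ∈ edgeOf ⁻¹' (↑W : Set (Sym2 (Site 2))), cert vd).Finite := fun W =>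
    (W.finite_toSet.preimage edgeOf_injective.injOn).biUnion fun vd _ =>
      (show (coinsOf k vd).Finite from ((Set.finite_singleton _).insert _).insert _).subset
        (hsub vd)
  have hcyl : ∀ W : Finset (Sym2 (Site 2)), (∀ e ∈ W, e ∈ (zdGraph 2).edgeSet) →
      ∀ T : Set Coin, (∀ i ∈ ⋃ vd ∈ edgeOf ⁻¹' (↑W : Set (Sym2 (Site 2))), cert vd,
        (i ∈ T ↔ i ∈ S)) → ∀ e ∈ W, (e ∈ cfg k T ↔ e ∈ cfg k S) := by
    intro W hW T hT e he
    obtain ⟨vd, rfl⟩ := exists_edgeOf_eq_of_mem_edgeSet (hW _ he)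
    rw [edgeOf_mem_cfg_iff_opn, edgeOf_mem_cfg_iff_opn]
    exact hcert vd T fun i hi =>
      hT i (Set.mem_biUnion (show vd ∈ edgeOf ⁻¹' (↑W : Set (Sym2 (Site 2))) from he) hi)
  refine ⟨⋃ vd ∈ edgeOf ⁻¹' (↑K : Set (Sym2 (Site 2))), cert vd,
    ⋃ vd ∈ edgeOf ⁻¹' (↑L : Set (Sym2 (Site 2))), cert vd, ?_, hfin K, hfin L, hcyl K hK,
    hcyl L hL⟩
  -- disjointness
  rw [Set.disjoint_left]
  intro i hiK hiL
  obtain ⟨vd, hvd, hi⟩ := Set.mem_iUnion₂.1 hiK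
  obtain ⟨vd', hvd', hi'⟩ := Set.mem_iUnion₂.1 hiL
  have hvdK : edgeOf vd ∈ K := hvd
  have hvdL : edgeOf vd' ∈ L := hvd'
  have hne : vd ≠ vd' := by
    rintro rfl
    exact Finset.disjoint_left.1 hKL hvdK hvdL
  have hci := hsub vd hi
  have hci' := hsub vd' hi'
  simp only [coinsOf, Set.mem_insert_iff, Set.mem_singleton_iff] at hci hci'
  rcases hci with rfl | rfl | rfl
  · -- a common OWN coin: the same edge, in `K` and in `L`
    rcases hci' with h | h | h
    · exact hne (Prod.ext (coin_eq_elim h).1 (coin_eq_elim h).2.1)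
    · exact absurd (coin_eq_elim h).2.2 (by decide)
    · exact absurd (coin_eq_elim h).2.2 (by decide)
  · -- a common SHARED coin: same bundle, opposite states, both states equal the shared coin
    have hax1 : ax k vd := haxC vd _ hi (show (1 : Fin 3) ≠ 0 by decide)
    rcases hci' with h | h | h
    · exact absurd (coin_eq_elim h).2.2 (by decide)
    · obtain ⟨htb, hd, -⟩ := coin_eq_elim h
      have hax2 : ax k vd' := haxC vd' _ hi' (show (1 : Fin 3) ≠ 0 by decide)
      have key := hopp vd vd' hvdK hvdL hax1 hax2 htb hd
      rw [edgeOf_mem_cfg_iff_opn, edgeOf_mem_cfg_iff_opn] at key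
      have t1 := hsh vd hax1 hi
      rw [htb, hd] at hi'
      have t2 := hsh vd' hax2 hi'
      rw [← htb, ← hd] at t2
      tauto
    · exact absurd (coin_eq_elim h).2.2 (by decide)
  · -- a common SELECTOR: same bundle, opposite states; selector on is impossible, selector off
    -- makes both states the negation of the shared coin
    have hax1 : ax k vd := haxC vd _ hi (show (2 : Fin 3) ≠ 0 by decide)
    rcases hci' with h | h | h
    · exact absurd (coin_eq_elim h).2.2 (by decide)
    · exact absurd (coin_eq_elim h).2.2 (by decide)
    · obtain ⟨htb, hd, -⟩ := coin_eq_elim h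
      have hax2 : ax k vd' := haxC vd' _ hi' (show (2 : Fin 3) ≠ 0 by decide)
      have key := hopp vd vd' hvdK hvdL hax1 hax2 htb hd
      rw [edgeOf_mem_cfg_iff_opn, edgeOf_mem_cfg_iff_opn] at key
      by_cases hon : (tb k vd, vd.2, (2 : Fin 3)) ∈ S
      · have o1 := opn_iff_shared_of_sel_mem hax1 hon
        rw [htb, hd] at hon
        have o2 := opn_iff_shared_of_sel_mem hax2 hon
        rw [← htb, ← hd] at o2
        tauto
      · have t1 := hsel vd hax1 hi hon
        rw [htb, hd] at hi' hon
        have t2 := hsel vd' hax2 hi' hon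
        rw [← htb, ← hd] at t2
        tauto

end Summit.CriticalPhenomena.CardyFormulaZ2.Theorems.CardySelfRefinement.FarField

end
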